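import Summits.CriticalPhenomena.CardyFormulaZ2.Theorems.CardyComplexConeParafermionToSLESixFamiliesDiamondDefs
import HarnessLib

/-!
# Line `potential-darboux-picard-diamond`, stub S4′ (`stub_identifyPotentialPh`): periodic increasing enumeration of finitely many parameters

Helper file of the stub `stub_identifyPotentialPh` of crux `ParafermionToSLESixFamilies` (stmt-CriticalPhenomena-11389).
Step (iii) of the identification subdivides the boundary loop of the marked diamond (period `L = 2π`) at the four
corner parameters and the two mark parameters, a finite set `T ⊆ [0, L)` containing `0`. This file provides the
abstract bookkeeping (`exists_periodic_enum`, registered helper of the crux item): the increasing enumeration of `T`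
extended `L`-periodically is a sequence `t : ℕ → ℝ` with `t 0 = 0`, `t j < t (j+1)`, `t (j + N) = t j + L`
(`N = #T`), every `t j` is a translate of a point of `T` by a multiple of `L`, every point of `T` is some `t j`
(`j < N`), NO translate of a point of `T` lies strictly between consecutive `t j < t (j+1)`, and sums of an
`L`-periodic function over `t 1, …, t N` are sums over `T`.
-/

noncomputable section

namespace Summit.CriticalPhenomena.CardyFormulaZ2.Cruxes.ParafermionToSLESixFamilies.PotentialDarbouxPicardDiamond

open scoped BigOperators
open Set Finset

/-- **Periodic increasing enumeration of a finite set of parameters.** -/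
theorem exists_periodic_enum : ∀ (T : Finset ℝ) (L : ℝ), 0 < L → (0:ℝ) ∈ T → (∀ x ∈ T, 0 ≤ x ∧ x < L) → ∃ (N : ℕ) (t : ℕ → ℝ), N = T.card ∧ 0 < N ∧ t 0 = 0 ∧ (∀ j, t j < t (j + 1)) ∧ (∀ j, t (j + N) = t j + L) ∧ (∀ j, 0 ≤ t j) ∧ (∀ j, ∃ x ∈ T, ∃ n : ℕ, t j = x + n * L) ∧ (∀ x ∈ T, ∃ j, j < N ∧ t j = x) ∧ (∀ j, ∀ x ∈ T, ∀ n : ℤ, ¬ (t j < x + n * L ∧ x + n * L < t (j + 1))) ∧ (∀ g : ℝ → ℝ, (∀ s, g (s + L) = g s) → ∑ j ∈ Finset.range N, g (t (j + 1)) = ∑ x ∈ T, g x) := by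
  intro T L hL h0 hT
  classical
  set N : ℕ := T.card with hN
  have hNpos : 0 < N := Finset.card_pos.2 ⟨0, h0⟩
  set f := T.orderEmbOfFin hN.symm with hf
  have hfmem : ∀ i, f i ∈ T := fun i => T.orderEmbOfFin_mem hN.symm i
  have hfsurj : ∀ x ∈ T, ∃ i : Fin N, f i = x := by
    intro x hx
    have : x ∈ Set.range f := by rw [hf, Finset.range_orderEmbOfFin]; exact hx
    exact this
  have hf0 : f ⟨0, hNpos⟩ = 0 := by
    rw [hf, Finset.orderEmbOfFin_zero hN.symm hNpos]
    apply le_antisymm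
    · exact Finset.min'_le _ _ h0
    · exact Finset.le_min' _ _ _ fun y hy => (hT y hy).1
  have hflt : ∀ i, f i < L := fun i => (hT _ (hfmem i)).2
  have hfnn : ∀ i, 0 ≤ f i := fun i => (hT _ (hfmem i)).1
  have hfmax : ∀ x ∈ T, x ≤ f ⟨N - 1, Nat.sub_lt hNpos one_pos⟩ := by
    intro x hx
    rw [hf, Finset.orderEmbOfFin_last hN.symm hNpos]
    exact Finset.le_max' _ _ hx
  -- the periodic extension
  set t : ℕ → ℝ := fun j => f ⟨j % N, Nat.mod_lt _ hNpos⟩ + (j / N : ℕ) * L with ht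
  have ht_def : ∀ j, t j = f ⟨j % N, Nat.mod_lt _ hNpos⟩ + (j / N : ℕ) * L := fun j => rfl
  -- successor arithmetic modulo `N`
  have hwrap : ∀ j, j % N = N - 1 → (j + 1) % N = 0 ∧ (j + 1) / N = j / N + 1 := by
    intro j hj
    have h := Nat.mod_add_div j N
    have hj1 : j + 1 = N * (j / N + 1) := by
      rw [Nat.mul_add, Nat.mul_one]; omega
    constructor
    · rw [hj1, Nat.mul_mod_right]
    · rw [hj1, Nat.mul_div_cancel_left _ hNpos]
  have hstep : ∀ j, j % N ≠ N - 1 → (j + 1) % N = j % N + 1 ∧ (j + 1) / N = j / N := by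
    intro j hj
    have h := Nat.mod_add_div j N
    have hlt : j % N + 1 < N := by have := Nat.mod_lt j hNpos; omega
    have hj1 : j + 1 = (j % N + 1) + N * (j / N) := by omega
    constructor
    · rw [hj1, Nat.add_mul_mod_self_left, Nat.mod_eq_of_lt hlt]
    · rw [hj1, Nat.add_mul_div_left _ _ hNpos, Nat.div_eq_of_lt hlt, zero_add]
  have ht0 : t 0 = 0 := by
    rw [ht_def]
    have : (⟨0 % N, Nat.mod_lt _ hNpos⟩ : Fin N) = ⟨0, hNpos⟩ := Fin.ext (Nat.zero_mod _)
    rw [this, hf0]; simp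
  have htper : ∀ j, t (j + N) = t j + L := by
    intro j
    rw [ht_def, ht_def]
    have h1 : (⟨(j + N) % N, Nat.mod_lt _ hNpos⟩ : Fin N) = ⟨j % N, Nat.mod_lt _ hNpos⟩ := Fin.ext (by simp)
    have h2 : (j + N) / N = j / N + 1 := Nat.add_div_right _ hNpos
    rw [h1, h2]; push_cast; ring
  have htlt : ∀ j, t j < t (j + 1) := by
    intro j
    rw [ht_def, ht_def]
    by_cases hlast : j % N = N - 1
    · -- wrap around
      obtain ⟨h1, h2⟩ := hwrap j hlast
      have h5 : (⟨(j + 1) % N, Nat.mod_lt _ hNpos⟩ : Fin N) = ⟨0, hNpos⟩ := Fin.ext h1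
      rw [h5, hf0, h2]
      push_cast
      linarith [hflt ⟨j % N, Nat.mod_lt _ hNpos⟩]
    · obtain ⟨h1, h2⟩ := hstep j hlast
      have hmono : f ⟨j % N, Nat.mod_lt _ hNpos⟩ < f ⟨(j + 1) % N, Nat.mod_lt _ hNpos⟩ := by
        apply f.strictMono
        rw [Fin.mk_lt_mk, h1]; exact Nat.lt_succ_self _
      rw [h2]; linarith
  have htnn : ∀ j, 0 ≤ t j := fun j => by rw [ht_def]; have := hfnn ⟨j % N, Nat.mod_lt _ hNpos⟩; positivity
  have htT : ∀ j, ∃ x ∈ T, ∃ n : ℕ, t j = x + n * L := fun j => ⟨_, hfmem _, j / N, ht_def j⟩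
  have hTt : ∀ x ∈ T, ∃ j, j < N ∧ t j = x := by
    intro x hx
    obtain ⟨i, hi⟩ := hfsurj x hx
    refine ⟨i.1, i.2, ?_⟩
    rw [ht_def]
    have h1 : (⟨i.1 % N, Nat.mod_lt _ hNpos⟩ : Fin N) = i := Fin.ext (Nat.mod_eq_of_lt i.2)
    rw [h1, hi, Nat.div_eq_of_lt i.2]; simp
  -- nothing of `T + Lℤ` strictly between consecutive parameters
  have hgap : ∀ j, ∀ x ∈ T, ∀ n : ℤ, ¬ (t j < x + n * L ∧ x + n * L < t (j + 1)) := by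
    rintro j x hx n ⟨h1, h2⟩
    obtain ⟨m, hm⟩ := hfsurj x hx
    have hx0 := (hT x hx).1
    have hxL := (hT x hx).2
    set i : ℕ := j % N with hi
    set q : ℕ := j / N with hq
    have hiN : i < N := Nat.mod_lt _ hNpos
    rw [ht_def] at h1
    by_cases hlast : i = N - 1
    · -- the wrap-around piece `[f (N-1) + qL, (q+1) L]`
      have ht1 : t (j + 1) = ((q + 1 : ℕ) : ℝ) * L := by
        rw [ht_def]
        obtain ⟨e1, e2⟩ := hwrap j (by rw [← hi]; exact hlast)
        have e3 : (⟨(j + 1) % N, Nat.mod_lt _ hNpos⟩ : Fin N) = ⟨0, hNpos⟩ := Fin.ext e1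
        rw [e3, hf0, e2, zero_add]
      rw [ht1] at h2
      push_cast at h2
      have hfi := hfnn ⟨i, hiN⟩
      -- `n = q`
      have hn : (n : ℝ) = q := by
        have hlt1 : ((n : ℝ) - q) * L < L := by nlinarith
        have hgt1 : -L < ((n : ℝ) - q) * L := by
          have := hflt ⟨i, hiN⟩; nlinarith
        have h3 : (n : ℝ) - q < 1 := by
          by_contra hcon; push Not at hcon; nlinarith
        have h4 : -1 < (n : ℝ) - q := by
          by_contra hcon; push Not at hcon; nlinarith
        have h5 : ((n - q : ℤ) : ℝ) < 1 := by push_cast; exact h3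
        have h6 : (-1 : ℝ) < ((n - q : ℤ) : ℝ) := by push_cast; exact h4
        have h7 : n - q < 1 := by exact_mod_cast h5
        have h8 : -1 < n - (q : ℤ) := by exact_mod_cast h6
        have : n = q := by omega
        rw [this]; simp
      rw [hn] at h1 h2
      have hxi : f ⟨i, hiN⟩ < x := by linarith
      have := hfmax x hx
      have hii : (⟨i, hiN⟩ : Fin N) = ⟨N - 1, Nat.sub_lt hNpos one_pos⟩ := Fin.ext hlast
      rw [hii] at hxi
      linarith
    · have hiN' : i + 1 < N := by omega
      have ht1 : t (j + 1) = f ⟨i + 1, hiN'⟩ + (q : ℝ) * L := by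
        rw [ht_def]
        obtain ⟨e1, e2⟩ := hstep j (by rw [← hi]; exact hlast)
        have e3 : (⟨(j + 1) % N, Nat.mod_lt _ hNpos⟩ : Fin N) = ⟨i + 1, hiN'⟩ := Fin.ext e1
        rw [e3, e2]
      rw [ht1] at h2
      have hn : (n : ℝ) = q := by
        have hfi := hfnn ⟨i, hiN⟩
        have hfi1 := hflt ⟨i + 1, hiN'⟩
        have h3 : (n : ℝ) - q < 1 := by
          by_contra hcon; push Not at hcon; nlinarith
        have h4 : -1 < (n : ℝ) - q := by
          by_contra hcon; push Not at hcon; nlinarith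
        have h5 : ((n - q : ℤ) : ℝ) < 1 := by push_cast; exact h3
        have h6 : (-1 : ℝ) < ((n - q : ℤ) : ℝ) := by push_cast; exact h4
        have h7 : n - q < 1 := by exact_mod_cast h5
        have h8 : -1 < n - (q : ℤ) := by exact_mod_cast h6
        have : n = q := by omega
        rw [this]; simp
      rw [hn] at h1 h2
      have hlo : f ⟨i, hiN⟩ < f m := by rw [hm]; linarith
      have hhi : f m < f ⟨i + 1, hiN'⟩ := by rw [hm]; linarith
      have h3 : (⟨i, hiN⟩ : Fin N) < m := f.lt_iff_lt.1 hlo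
      have h4 : m < ⟨i + 1, hiN'⟩ := f.lt_iff_lt.1 hhi
      rw [Fin.lt_def] at h3 h4
      simp only at h3 h4
      omega
  -- sums over one period are sums over `T`
  have hsum : ∀ g : ℝ → ℝ, (∀ s, g (s + L) = g s) → ∑ j ∈ Finset.range N, g (t (j + 1)) = ∑ x ∈ T, g x := by
    intro g hg
    -- shift the window by one using periodicity
    have hshift : ∑ j ∈ Finset.range N, g (t (j + 1)) = ∑ j ∈ Finset.range N, g (t j) := by
      have h1 := Finset.sum_range_succ' (fun j => g (t j)) N
      have h2 := Finset.sum_range_succ (fun j => g (t j)) N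
      have h3 : g (t N) = g (t 0) := by rw [show N = 0 + N from (zero_add N).symm, htper 0, hg]
      linarith
    rw [hshift, Finset.sum_range (fun j => g (t j))]
    have h4 : ∀ i : Fin N, g (t i) = g (f i) := by
      intro i
      rw [ht_def]
      have e1 : (⟨i.1 % N, Nat.mod_lt _ hNpos⟩ : Fin N) = i := Fin.ext (Nat.mod_eq_of_lt i.2)
      rw [e1, Nat.div_eq_of_lt i.2]; simp
    rw [Finset.sum_congr rfl fun i _ => h4 i]
    have h5 := Finset.sum_map Finset.univ f.toEmbedding g
    rw [Finset.map_orderEmbOfFin_univ] at h5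
    rw [h5]; rfl
  exact ⟨N, t, rfl, hNpos, ht0, htlt, htper, htnn, htT, hTt, hgap, hsum⟩

end Summit.CriticalPhenomena.CardyFormulaZ2.Cruxes.ParafermionToSLESixFamilies.PotentialDarbouxPicardDiamond

end
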